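import Literature.Analysis.Complex.LittlePicard
import Literature.Analysis.Complex.UnitDiscAutomorphisms
import Mathlib.Analysis.Complex.Schwarz
import Mathlib.Topology.Homotopy.Lifting
import Mathlib.Analysis.Convex.Contractible
import Mathlib.AlgebraicTopology.FundamentalGroupoid.SimplyConnected
import HarnessLib

/-!
# Holomorphic coverings of a plane domain by the disc: lifting, extremality, uniqueness up to rotation

PROOF-ONLY file (no definitions; abc-iut cell, seat abc-iut-w5-d038 gen 6, programme «UNIF-G1P» of
abc-iut-L4-t8 behind the named fact `Complex.PlaneDomainDiscCovering`, GAP row G-L4t8g7-1).  The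
converse and the uniqueness half of Y. Fisher, J. H. Hubbard, B. S. Wittner, *A proof of the uniformization
theorem for arbitrary plane domains*, Proc. AMS **104** (1988) 413–418, Concluding remarks (1)–(2)
p. 417 («`Ũ` is isomorphic with `D` … a universal covering map for `U`»; «we can make the `f_n` and `π_n`
converge … by normalizing their derivatives to be positive»), for a holomorphic map `π : 𝔻 → U` whose
restriction `𝔻 → U` is a covering map (`U ⊆ ℂ` open):

* `Complex.deriv_ne_zero_of_isCoveringMap_ball` — `π′ ≠ 0` on `𝔻` (a covering map is locally injective;
  tree `SCV.deriv_ne_zero_of_injOn`);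
* `Complex.exists_discLift_of_isCoveringMap` — the BASED HOLOMORPHIC DISC-LIFTING PROPERTY: every
  holomorphic `g : 𝔻 → U` lifts through `π` to a holomorphic `ĝ : 𝔻 → 𝔻` through any point of `𝔻`
  over `g 0` (Mathlib `IsCoveringMap.existsUnique_continuousMap_lifts` + tree
  `analyticAt_of_comp_eq_of_deriv_ne_zero`) — so the disc-lifting property of
  `PlaneDomainExtremalDiscLift.lean` CHARACTERISES holomorphic coverings by the disc;
* `Complex.eqOn_of_lifts_of_isCoveringMap` — two continuous lifts `𝔻 → 𝔻` of the same map agreeing at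
  one point agree (Mathlib `IsCoveringMap.eq_of_comp_eq`);
* **`Complex.norm_deriv_le_of_isCoveringMap`** — a holomorphic covering `π : 𝔻 → U` MAXIMISES `‖f′(0)‖`
  among holomorphic `f : 𝔻 → U` with `f 0 = π 0` (lift + Schwarz): the universal covering is an
  extremal map of brick N1b;
* **`Complex.exists_rotation_of_isCoveringMap`** — UNIQUENESS: two holomorphic coverings
  `π₁, π₂ : 𝔻 → U` with `π₁ 0 = π₂ 0` satisfy `π₂ z = π₁ (c z)` for a constant `‖c‖ = 1` (the mutual
  lifts are inverse automorphisms of `𝔻` fixing `0`; tree `IsDiscAut.exists_eq_mul_of_map_zero`).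

Classical mathematics; nothing here touches [IUTchIII] Cor. 3.12.
[cite: FisherHubbardWittner1988, §4 Concluding remarks (1)(2) p.417]
-/

noncomputable section

open Set Metric Filter Topology Function

namespace Complex

variable {U : Set ℂ} {π : ℂ → ℂ}

/-- **A holomorphic covering has non-vanishing derivative**: if `π` is holomorphic on `𝔻` and its
restriction `𝔻 → U` is a covering map, then `π′(z) ≠ 0` for `z ∈ 𝔻` (a covering map is a local
homeomorphism, and an injective holomorphic function has non-zero derivative).
[cite: FritzscheGrauert2002, Ch. I §8 Thm. 8.5] -/
theorem deriv_ne_zero_of_isCoveringMap_ball (hπ : DifferentiableOn ℂ π (ball 0 1))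
    (hπU : MapsTo π (ball (0 : ℂ) 1) U) (hcov : IsCoveringMap hπU.restrict) {z : ℂ}
    (hz : z ∈ ball (0 : ℂ) 1) : deriv π z ≠ 0 := by
  obtain ⟨e, he, heq⟩ := hcov.isLocalHomeomorph ⟨z, hz⟩
  have hval : ∀ w : ball (0 : ℂ) 1, ((e w : U) : ℂ) = π w := fun w => by
    have := congrArg Subtype.val (congrFun heq w)
    simpa [MapsTo.restrict, Subtype.map] using this.symm
  have hinj : InjOn (fun w : ball (0 : ℂ) 1 => π w) e.source := by
    intro x hx y hy hxy
    refine e.injOn hx hy (Subtype.ext ?_)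
    rw [hval, hval]
    exact hxy
  have hW : IsOpen (((↑) : ball (0 : ℂ) 1 → ℂ) '' e.source) :=
    isOpen_ball.isOpenEmbedding_subtypeVal.isOpenMap _ e.open_source
  have hWsub : ((↑) : ball (0 : ℂ) 1 → ℂ) '' e.source ⊆ ball 0 1 := by
    rintro _ ⟨x, -, rfl⟩; exact x.2
  have hinjW : InjOn π (((↑) : ball (0 : ℂ) 1 → ℂ) '' e.source) := by
    rintro _ ⟨x, hx, rfl⟩ _ ⟨y, hy, rfl⟩ hxy
    rw [hinj hx hy hxy]
  exact Literature.Analysis.Complex.SCV.deriv_ne_zero_of_injOn (hπ.mono hWsub) hW hinjW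
    ⟨⟨z, hz⟩, he, rfl⟩

/-- **Based holomorphic disc-lifting through a holomorphic covering by the disc.**  If `π` is
holomorphic on `𝔻` with `π(𝔻) ⊆ U` and `𝔻 → U` a covering map, then every holomorphic `g : 𝔻 → U`
lifts through `π`: for `z₀ ∈ 𝔻` with `π z₀ = g 0` there is a holomorphic `ĝ : 𝔻 → 𝔻` with `ĝ 0 = z₀`
and `π ∘ ĝ = g` on `𝔻` (topological lifting from the simply connected disc, holomorphic because
`π′ ≠ 0`). [cite: FisherHubbardWittner1988, §3 Part c p.415 (the lifts f_n)] -/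
theorem exists_discLift_of_isCoveringMap (hπ : DifferentiableOn ℂ π (ball 0 1))
    (hπU : MapsTo π (ball (0 : ℂ) 1) U) (hcov : IsCoveringMap hπU.restrict)
    {g : ℂ → ℂ} (hg : DifferentiableOn ℂ g (ball 0 1)) (hgU : MapsTo g (ball (0 : ℂ) 1) U)
    {z₀ : ℂ} (hz₀ : z₀ ∈ ball (0 : ℂ) 1) (h0 : π z₀ = g 0) :
    ∃ gl : ℂ → ℂ, DifferentiableOn ℂ gl (ball 0 1) ∧ MapsTo gl (ball 0 1) (ball 0 1) ∧ gl 0 = z₀ ∧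
      ∀ z ∈ ball (0 : ℂ) 1, π (gl z) = g z := by
  classical
  haveI : ContractibleSpace (ball (0 : ℂ) 1) :=
    (convex_ball (0 : ℂ) 1).contractibleSpace ⟨0, mem_ball_self one_pos⟩
  haveI : LocallyPathConnectedSpace (ball (0 : ℂ) 1) := isOpen_ball.locallyPathConnectedSpace
  set g' : C(ball (0 : ℂ) 1, U) :=
    ⟨fun a => ⟨g a, hgU a.2⟩, (hg.continuousOn.comp_continuous continuous_subtype_val
      fun a => a.2).subtype_mk _⟩ with hg'
  obtain ⟨G, ⟨hG0, hG⟩, -⟩ := hcov.existsUnique_continuousMap_lifts g' ⟨0, mem_ball_self one_pos⟩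
    ⟨z₀, hz₀⟩ (Subtype.ext (by simpa [hg', MapsTo.restrict, Subtype.map] using h0))
  -- the lift as a function on `ℂ`
  let gl : ℂ → ℂ := fun z => if h : z ∈ ball (0 : ℂ) 1 then ((G ⟨z, h⟩ : ball (0 : ℂ) 1) : ℂ) else z₀
  have hval : ∀ z (h : z ∈ ball (0 : ℂ) 1), gl z = ((G ⟨z, h⟩ : ball (0 : ℂ) 1) : ℂ) :=
    fun z h => dif_pos h
  have hglm : MapsTo gl (ball 0 1) (ball 0 1) := fun z h => by rw [hval z h]; exact (G ⟨z, h⟩).2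
  have hπgl : ∀ z ∈ ball (0 : ℂ) 1, π (gl z) = g z := fun z h => by
    rw [hval z h]
    have := congrArg Subtype.val (congrFun hG ⟨z, h⟩)
    simpa [hg', MapsTo.restrict, Subtype.map] using this
  have hgl0 : gl 0 = z₀ := by
    rw [hval 0 (mem_ball_self one_pos), hG0]
  have hglc : ContinuousOn gl (ball 0 1) := by
    rw [continuousOn_iff_continuous_restrict]
    have : (ball (0 : ℂ) 1).restrict gl = fun a => ((G a : ball (0 : ℂ) 1) : ℂ) := by
      funext a; exact hval a a.2
    rw [this]
    exact continuous_subtype_val.comp G.continuous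
  refine ⟨gl, fun z hz => ?_, hglm, hgl0, hπgl⟩
  have hzn : ball (0 : ℂ) 1 ∈ 𝓝 z := isOpen_ball.mem_nhds hz
  have han : AnalyticAt ℂ π (gl z) := hπ.analyticAt (isOpen_ball.mem_nhds (hglm hz))
  have hev : ∀ᶠ w in 𝓝 z, π (gl w) = g w := by
    filter_upwards [hzn] with w hw using hπgl w hw
  exact (Literature.Analysis.Complex.analyticAt_of_comp_eq_of_deriv_ne_zero han
    (deriv_ne_zero_of_isCoveringMap_ball hπ hπU hcov (hglm hz)) (hglc.continuousAt hzn)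
    (hg.analyticAt hzn) hev).differentiableAt.differentiableWithinAt

/-- **Uniqueness of lifts through a covering by the disc**: two continuous maps `𝔻 → 𝔻` with
`π ∘ φ₁ = π ∘ φ₂` on `𝔻` that agree at one point of `𝔻` agree on `𝔻` (the unique lifting property,
Hatcher Prop. 1.34). [cite: HatcherAT2002, §1.3 Prop. 1.34] -/
theorem eqOn_of_lifts_of_isCoveringMap (hπU : MapsTo π (ball (0 : ℂ) 1) U)
    (hcov : IsCoveringMap hπU.restrict) {φ₁ φ₂ : ℂ → ℂ}
    (h₁ : ContinuousOn φ₁ (ball 0 1)) (hm₁ : MapsTo φ₁ (ball (0 : ℂ) 1) (ball 0 1))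
    (h₂ : ContinuousOn φ₂ (ball 0 1)) (hm₂ : MapsTo φ₂ (ball (0 : ℂ) 1) (ball 0 1))
    (heq : ∀ z ∈ ball (0 : ℂ) 1, π (φ₁ z) = π (φ₂ z)) {a : ℂ} (ha : a ∈ ball (0 : ℂ) 1)
    (hφa : φ₁ a = φ₂ a) : EqOn φ₁ φ₂ (ball 0 1) := by
  haveI : PreconnectedSpace (ball (0 : ℂ) 1) :=
    isPreconnected_iff_preconnectedSpace.1 (convex_ball (0 : ℂ) 1).isPreconnected
  set g₁ : ball (0 : ℂ) 1 → ball (0 : ℂ) 1 := hm₁.restrict with hg₁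
  set g₂ : ball (0 : ℂ) 1 → ball (0 : ℂ) 1 := hm₂.restrict with hg₂
  have hc₁ : Continuous g₁ := h₁.mapsToRestrict hm₁
  have hc₂ : Continuous g₂ := h₂.mapsToRestrict hm₂
  have hcomp : hπU.restrict ∘ g₁ = hπU.restrict ∘ g₂ := by
    funext x
    exact Subtype.ext (by simpa [hg₁, hg₂, MapsTo.restrict, Subtype.map] using heq x x.2)
  have h := hcov.eq_of_comp_eq hc₁ hc₂ hcomp ⟨a, ha⟩ (Subtype.ext (by simpa [hg₁, hg₂] using hφa))
  intro z hz
  have := congrArg Subtype.val (congrFun h ⟨z, hz⟩)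
  simpa [hg₁, hg₂] using this

/-- **A holomorphic covering by the disc is extremal** (Fisher–Hubbard–Wittner, Concluding remark (1):
the limit is «a universal covering map for `U`»; conversely the universal covering solves the extremal
problem): if `π` is holomorphic on `𝔻` with `𝔻 → U` a covering map, then `‖f′(0)‖ ≤ ‖π′(0)‖` for every
holomorphic `f : 𝔻 → U` with `f 0 = π 0` — lift `f = π ∘ f̃` and apply the Schwarz lemma to `f̃`.
[cite: FisherHubbardWittner1988, §4 Concluding remark (1) p.417] -/
theorem norm_deriv_le_of_isCoveringMap (hπ : DifferentiableOn ℂ π (ball 0 1))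
    (hπU : MapsTo π (ball (0 : ℂ) 1) U) (hcov : IsCoveringMap hπU.restrict)
    {f : ℂ → ℂ} (hf : DifferentiableOn ℂ f (ball 0 1)) (hfU : MapsTo f (ball (0 : ℂ) 1) U)
    (h0 : f 0 = π 0) : ‖deriv f 0‖ ≤ ‖deriv π 0‖ := by
  have hb : ball (0 : ℂ) 1 ∈ 𝓝 (0 : ℂ) := isOpen_ball.mem_nhds (mem_ball_self one_pos)
  obtain ⟨φ, hφd, hφm, hφ0, hπφ⟩ :=
    exists_discLift_of_isCoveringMap hπ hπU hcov hf hfU (mem_ball_self one_pos) h0.symm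
  have hev : f =ᶠ[𝓝 0] fun z => π (φ z) := by
    filter_upwards [hb] with z hz using (hπφ z hz).symm
  have h1 : DifferentiableAt ℂ φ 0 := hφd.differentiableAt hb
  have h2 : DifferentiableAt ℂ π (φ 0) := hπ.differentiableAt (by rw [hφ0]; exact hb)
  rw [hev.deriv_eq, show (fun z => π (φ z)) = π ∘ φ from rfl, deriv_comp 0 h2 h1, hφ0, norm_mul]
  have hS : ‖deriv φ 0‖ ≤ 1 := by
    refine norm_deriv_le_one_of_mapsTo_ball hφd ?_ one_pos
    rw [hφ0]
    exact hφm.mono_right ball_subset_closedBall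
  exact mul_le_of_le_one_right (norm_nonneg _) hS

/-- **Uniqueness of the holomorphic universal covering by the disc up to rotation**
(Fisher–Hubbard–Wittner, Concluding remark (2): «an arbitrary rotation composed with `π_n` is not
important»): if `π₁, π₂` are holomorphic on `𝔻`, map `𝔻` into the open set `U`, restrict to covering
maps `𝔻 → U`, and `π₁ 0 = π₂ 0`, then `π₂ z = π₁ (c z)` on `𝔻` for some `‖c‖ = 1` (the mutual lifts
are inverse holomorphic automorphisms of `𝔻` fixing `0`, hence rotations by the Schwarz lemma).
[cite: FisherHubbardWittner1988, §4 Concluding remark (2) p.417] -/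
theorem exists_rotation_of_isCoveringMap {π₁ π₂ : ℂ → ℂ}
    (hπ₁ : DifferentiableOn ℂ π₁ (ball 0 1)) (hπ₁U : MapsTo π₁ (ball (0 : ℂ) 1) U)
    (hcov₁ : IsCoveringMap hπ₁U.restrict)
    (hπ₂ : DifferentiableOn ℂ π₂ (ball 0 1)) (hπ₂U : MapsTo π₂ (ball (0 : ℂ) 1) U)
    (hcov₂ : IsCoveringMap hπ₂U.restrict) (h0 : π₁ 0 = π₂ 0) :
    ∃ c : ℂ, ‖c‖ = 1 ∧ ∀ z ∈ ball (0 : ℂ) 1, π₂ z = π₁ (c * z) := by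
  have hb0 : (0 : ℂ) ∈ ball (0 : ℂ) 1 := mem_ball_self one_pos
  -- the mutual lifts
  obtain ⟨φ, hφd, hφm, hφ0, hπφ⟩ := exists_discLift_of_isCoveringMap hπ₁ hπ₁U hcov₁ hπ₂ hπ₂U hb0 h0
  obtain ⟨ψ, hψd, hψm, hψ0, hπψ⟩ :=
    exists_discLift_of_isCoveringMap hπ₂ hπ₂U hcov₂ hπ₁ hπ₁U hb0 h0.symm
  -- `φ ∘ ψ = id` and `ψ ∘ φ = id` on `𝔻` by uniqueness of lifts
  have hφψ : ∀ z ∈ ball (0 : ℂ) 1, φ (ψ z) = z := by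
    have := eqOn_of_lifts_of_isCoveringMap hπ₁U hcov₁ (φ₁ := fun z => φ (ψ z)) (φ₂ := id)
      (hφd.continuousOn.comp hψd.continuousOn hψm) (hφm.comp hψm) continuousOn_id (mapsTo_id _)
      (fun z hz => by simp only [id, hπφ _ (hψm hz), hπψ z hz]) hb0 (by simp [hψ0, hφ0])
    exact fun z hz => this hz
  have hψφ : ∀ z ∈ ball (0 : ℂ) 1, ψ (φ z) = z := by
    have := eqOn_of_lifts_of_isCoveringMap hπ₂U hcov₂ (φ₁ := fun z => ψ (φ z)) (φ₂ := id)
      (hψd.continuousOn.comp hφd.continuousOn hφm) (hψm.comp hφm) continuousOn_id (mapsTo_id _)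
      (fun z hz => by simp only [id, hπψ _ (hφm hz), hπφ z hz]) hb0 (by simp [hψ0, hφ0])
    exact fun z hz => this hz
  -- `φ` is an automorphism of `𝔻` fixing `0`, hence a rotation
  have hAut : Literature.Analysis.Complex.IsDiscAut φ := ⟨hφd, hφm, ψ, hψd, hψm, hψφ, hφψ⟩
  obtain ⟨c, hc, hcφ⟩ := hAut.exists_eq_mul_of_map_zero hφ0
  exact ⟨c, hc, fun z hz => by rw [← hπφ z hz, hcφ hz]⟩

end Complex

end
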